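import Mathlib
import Summits.NavierStokesRegularity.NavierStokesRegularity.Theses.QuarterLogPincer
import HarnessLib

/-!
# `QuarterLogPincer.Assembly` — the route's assembly (item stmt-NavierStokesRegularity-23364; pure logic)

**Statement.** `EnstrophyQuarterLaw → RecordTimeTypeI → LogCubeCeiling → SuperlogTypeIRate →
NavierStokesRegularity`.

PROOF. The route file carries the planner-authored, kernel-checked deciding theorem
`Theses.QuarterLogPincer.closes` with exactly these hypotheses; the assembly is its curried form.
This proves an IMPLICATION only: the hypotheses (among them open cruxes) remain hypotheses.

HONEST FRAMING: pure logic between the route's own statements; the file does NOT prove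
`NavierStokesRegularity`.
-/

noncomputable section

set_option linter.dupNamespace false

namespace Summit.NavierStokesRegularity.NavierStokesRegularity.Theorems

open Summit.NavierStokesRegularity.NavierStokesRegularity.Theses.QuarterLogPincer in
/-- **Item stmt-NavierStokesRegularity-23364** (`QuarterLogPincer.Assembly`): the route's items imply the
sub-problem Statement, by the route file's deciding theorem `closes` (an implication; its hypotheses
stay hypotheses). [this file] -/
theorem quarterLogPincer_assembly_proof :
    Summit.NavierStokesRegularity.NavierStokesRegularity.Theses.QuarterLogPincer.Assembly := by
  unfold Summit.NavierStokesRegularity.NavierStokesRegularity.Theses.QuarterLogPincer.Assembly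
  intro hQ hR hC hS
  -- The route's `closes` was re-keyed (rev 2026-08-28) to `LogCubeSharp` / `SuperlogCubeRate`; the
  -- accepted `Assembly` statement is over `LogCubeCeiling` / `SuperlogTypeIRate`, so the pre-edit
  -- chain of `closes` is inlined here (same contradiction: ceiling vs super-log rate at one time t).
  refine Summit.NavierStokesRegularity.NavierStokesRegularity.Theorems.navierStokesRegularity_of_noBlowup ?_
  intro ν T hν hT u p hcl hLH hdec
  by_contra hext
  obtain ⟨K, hK⟩ := hQ ν T hν hT u p ⟨hcl, hext⟩ hLH hdec
  have hI : Literature.Analysis.FluidPDE.IsTypeIBlowup u T := hR ν T hν hT u p hcl hLH hdec K hK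
  obtain ⟨C₁, C₂, hceil⟩ := hC ν T hν hT u p hcl hLH hdec K hK hI
  obtain ⟨t, ht, hlt⟩ := hS ν T hν hT u p hcl hLH hdec hext hI C₁ C₂
  exact absurd (hceil t ht) (not_le.mpr hlt)

end Summit.NavierStokesRegularity.NavierStokesRegularity.Theorems

end
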